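import Mathlib
import Summits.Ventures.FusionMHD.Models.SAlphaPolyWitnessS3A555Panels0
import HarnessLib

/-!
# F3 «F3.BALLOON-sα-S3-A555-POLY-WITNESS»: at `(s, α) = (3, 111/20)` — just BELOW the model's SECOND stability edge at shear `3` — the `s–α` ballooning MODEL is on the UNSTABLE side: an explicit polynomial trial function on the short window `[−4, 4]` with kernel-certified NEGATIVE energy (`SAlpha.UnstableWitness 3 (111/20) (−4) 4`); with model-7's second-stability stable side at `(3, 6)` the SECOND edge at `s = 3` lies in `[111/20, 6]`

LADDER-GRIDFUSION rung F3 (cell `gridfusion`; DIRECTOR RULING 67 (5): the second-stability side is a row class of its own — this file is the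
UNSTABLE end of the second-edge bracket at `s = 3`).  Assembly by gridfusion-model-7 g9, 2026-08-28, in model-7's poly-witness lane: (i) the data file
`SAlphaPolyWitnessS3A555Defs` (a NEW even degree-26 polynomial `X = UX` on `[−4, 4]`, float Rayleigh–Ritz design at `(3, 11/2)`, exact dyadics, `X(±4) = 0`;
program `pw10Prog` at `(3, 111/20)`), (ii) ONE panel file (11 kernel-decided Taylor-model integral enclosures, graded grid `1/4` on `[0, 3]`, `1/8` on `[3, 15/4]`,
`1/16` on `[15/4, 4]`), (iii) here: the point theorem.  The companion file `SAlphaPolyWitnessS3A555B` certifies the SAME `X` at `α = 26/5` and, by lit-3's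
convexity in `α`, the interval `[26/5, 111/20]`; model-7's `SAlphaPolyWitnessS3A52` gives `[19/10, 26/5]` with the first-edge trial function.  0 kit in the
kernel objects; no `native_decide`; `π` does not enter.

## THREE COLUMNS
CERTIFIED: in the `s–α` ballooning MODEL (Freidberg (12.96)–(12.99)) at `(s, α) = (3, 111/20)` the explicit trial function `X = Poly.eval UX` on `[−4, 4]`
(even polynomial of degree 26 vanishing at `±4`) has one-surface energy `W ≤ −7/100 < 0` (`X(0) ≈ 1`): `SAlpha.UnstableWitness 3 (111/20) (−4) 4 X X′`
(`unstableWitness_three_555`) — the unstable set `U₃` contains `111/20 = 5.55`; with a certified stable surface above it (model-7's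
`SAlphaSecondStableS3A6Point.stableSide_three_six : SAlpha.StableSide 3 6`, in flight) `sup {α ≤ 6 : α ∈ U₃}` — the model's SECOND stability edge at
shear `3` — lies in the CLOSED interval `[111/20, 6]`; monotonicity / connectedness NOT typed here (the interval files supply connectedness on
`[19/10, 111/20]`).  VALIDATED (not in the kernel): E–L shooting (model-7 kit j304843, even + odd solutions, zero on `(0, 150]`) puts the second edge at
`α ≈ 5.61`; float energies of this `X` along `s = 3`: `−1.18, −0.83, −0.42, −0.195, −0.077, +0.045` at `α = 5, 5.2, 5.4, 5.5, 5.55, 5.6`; kernel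
enclosure of the half integral `[−0.038827, −0.037752]`.  MODELLED: `s–α` model (large-aspect-ratio shifted circles, high-`n` ballooning ordering,
`θ₀ = 0`, ideal MHD); «unstable» = the MODEL's one-surface energy admits a negative compactly supported trial function (lit-3's witness class;
representation step `W̄ < 0 ⇒ δW < 0`, Connor–Hastie–Taylor 1979, quoted in the Literature file, NOT typed); nothing about `θ₀ ≠ 0`, a device, or a
`β`-limit.  Citations: Freidberg 2014 §12.3 (12.38)–(12.40), §12.6.2 (12.97)–(12.100), Fig. 12.5 [Freidberg2014]; Mahboubi–Melquiond–Sibut-Pinote 2016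
[MahboubiMelquiondSibutpinote2016]; Makino–Berz 2003 [MakinoBerz2003].  Everything below is [instance data].
-/

open MeasureTheory
open Literature.Analysis.ValidatedNumerics Literature.Analysis.ValidatedNumerics.PolyMP
open Literature.Analysis.ValidatedNumerics.NumericsMP Literature.Analysis.ValidatedNumerics.ExpPoly
open Literature.MathematicalPhysics.MHD.Ballooning
open Real Set

namespace Summit.Ventures.FusionMHD.Models

namespace SAlphaPolyWitnessS3A555

/-! ### §1 The trial function: derivative, zeros at `±4`, parity -/

/-- `Poly.deriv UX = UXd`. [instance data] -/
private theorem deriv_UX : Poly.deriv UX = UXd := by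
  decide +kernel

/-- `X(4) = 0` (exact). [instance data] -/
private theorem UX_at_L : Poly.eval UX (4 : ℝ) = 0 := by
  norm_num [UX, Poly.eval]

/-- `X(−4) = 0` (exact). [instance data] -/
private theorem UX_at_negL : Poly.eval UX (-4 : ℝ) = 0 := by
  norm_num [UX, Poly.eval]

/-- `X` is even. [instance data] -/
private theorem UX_even (θ : ℝ) : Poly.eval UX (-θ) = Poly.eval UX θ := by
  simp only [UX, Poly.eval]
  push_cast
  ring

/-- `X′` is odd. [instance data] -/
private theorem UXd_odd (θ : ℝ) : Poly.eval UXd (-θ) = -Poly.eval UXd θ := by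
  simp only [UXd, Poly.eval]
  push_cast
  ring

/-- `X′ = Poly.eval UXd` is the derivative of `X = Poly.eval UX` everywhere. [instance data] -/
private theorem hasDerivAt_UX (θ : ℝ) : HasDerivAt (Poly.eval UX) (Poly.eval UXd θ) θ := by
  have h := Poly.hasDerivAt_eval UX θ
  rwa [deriv_UX] at h

/-! ### §2 The energy density of `X`: parity, continuity, the certified half-window integral -/

/-- The energy density of the even `X` is even in `θ`. [instance data] -/
private theorem density_even (θ : ℝ) : (SAlpha.energyDensity 3 (111 / 20) (Poly.eval UX) (Poly.eval UXd)) (-θ) = (SAlpha.energyDensity 3 (111 / 20) (Poly.eval UX) (Poly.eval UXd)) θ := by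
  unfold SAlpha.energyDensity SAlpha.bending SAlpha.drive SAlpha.shearParam
  rw [UX_even, UXd_odd, Real.sin_neg, Real.cos_neg]
  ring

/-- The energy density of `X` is continuous. [instance data] -/
private theorem density_continuous : Continuous (SAlpha.energyDensity 3 (111 / 20) (Poly.eval UX) (Poly.eval UXd)) := by
  have h1 : Continuous (Poly.eval UX) := Poly.continuous_eval UX
  have h2 : Continuous (Poly.eval UXd) := Poly.continuous_eval UXd
  unfold SAlpha.energyDensity SAlpha.bending SAlpha.drive SAlpha.shearParam
  fun_prop

/-- THE CERTIFIED HALF-WINDOW INTEGRAL: `∫₀^4 [(1+Λ²)X′² − α(Λ sin θ + cos θ)X²] dθ ≤ -7/200` (kernel enclosure of the 11 panels: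
`[-0.038827, -0.037752]`; float value `-0.038297`). [instance data] -/
theorem half_integral_le : ∫ θ in (0 : ℝ)..4, (SAlpha.energyDensity 3 (111 / 20) (Poly.eval UX) (Poly.eval UXd)) θ ≤ (-7 / 200 : ℝ) := by
  have hseg := pw10_seg0
  have hb := (hseg.bounds (by norm_num) (lo' := -1) (hi' := -7/200) (by norm_num) (by norm_num)).2
  have e0 : ((panelLeft (1/4 : ℚ) 0 : ℚ) : ℝ) = 0 := by norm_num [panelLeft]
  have e1 : ((panelLeft (1/16 : ℚ) 32 : ℚ) : ℝ) = 4 := by norm_num [panelLeft]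
  have ei : ∀ t : ℝ, (TProg.toFunP (pw10Prog UX UXd) []) t * Poly.eval [1] t = (SAlpha.energyDensity 3 (111 / 20) (Poly.eval UX) (Poly.eval UXd)) t := by
    intro t
    rw [toFunP_pw10Prog]
    simp [Poly.eval]
  rw [e0, e1] at hb
  simp only [ei] at hb
  norm_num at hb ⊢
  exact hb

/-- THE CERTIFIED ENERGY: `W[X; −4, 4] ≤ -7/100 < 0` (reflection `θ ↦ −θ` doubles the half-window integral). [instance data] -/
theorem energy_le : SAlpha.energy 3 (111 / 20) (Poly.eval UX) (Poly.eval UXd) (-4) 4 ≤ (-7 / 100 : ℝ) := by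
  unfold SAlpha.energy
  have hint : ∀ a b : ℝ, IntervalIntegrable (SAlpha.energyDensity 3 (111 / 20) (Poly.eval UX) (Poly.eval UXd)) volume a b :=
    fun a b => density_continuous.intervalIntegrable a b
  have hsplit := intervalIntegral.integral_add_adjacent_intervals (hint (-4) 0) (hint 0 4)
  have hrefl : ∫ θ in (-4 : ℝ)..0, (SAlpha.energyDensity 3 (111 / 20) (Poly.eval UX) (Poly.eval UXd)) θ = ∫ θ in (0 : ℝ)..4, (SAlpha.energyDensity 3 (111 / 20) (Poly.eval UX) (Poly.eval UXd)) θ := by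
    have h1 := intervalIntegral.integral_comp_neg (a := (0 : ℝ)) (b := 4) (SAlpha.energyDensity 3 (111 / 20) (Poly.eval UX) (Poly.eval UXd))
    simp only [neg_zero] at h1
    rw [← h1]
    exact intervalIntegral.integral_congr fun x _ => density_even x
  have hh := half_integral_le
  linarith

/-! ### §3 The witness -/

/-- **THE ROW: `(s, α) = (3, 111/20)` IS ON THE UNSTABLE SIDE OF THE `s–α` MODEL** — the explicit even polynomial `X = Poly.eval UX`
(degree 26, `X(±4) = 0`) is a compactly supported trial function on the window `[−4, 4]` with NEGATIVE one-surface energy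
(`≤ -7/100` with `X(0) ≈ 1`), i.e. an `SAlpha.UnstableWitness 3 (111/20) (−4) 4`.  MODEL `s–α`; «unstable» in the model's own one-surface (Newcomb / trial-function)
sense; nothing about a device. [instance data] -/
theorem unstableWitness_three_555 : SAlpha.UnstableWitness 3 (111 / 20) (-4) 4 (Poly.eval UX) (Poly.eval UXd) := by
  refine ⟨by norm_num, fun θ _ => hasDerivAt_UX θ, UX_at_negL, UX_at_L, ?_⟩
  have h := energy_le
  linarith

end SAlphaPolyWitnessS3A555

end Summit.Ventures.FusionMHD.Models
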